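import Summits.CriticalPhenomena.Ising3DConformalLimit.Theses.HyperoctahedralRP
import Summits.CriticalPhenomena.Ising3DConformalLimit.Cruxes.ExistsScaleCovariantLimit.BlockZoomSupport
import Literature.Probability.LatticeModels.SourcedDoubleCurrents
import Literature.Probability.LatticeModels.PairIsing
import Literature.Probability.LatticeModels.IsingThermodynamics

/-!
# Sketch — crux-ideate round 2, ideator 4, crux `ExistsScaleCovariantLimit` (stmt-CriticalPhenomena-1981)

First lemmas / typed levers for the three idea cards of this seat (none is proved here; every
declaration must ELABORATE over existing tree declarations):

* §1 `decimation-homotopy-rate`: the two-coupling (nearest-neighbour `K` + sublattice range-`p`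
  `J`) critical family, its critical curve, the exact endpoint identity, the finite-volume response
  identity, and the load-bearing PATH RIGIDITY (local universality with a rate).
* §2 `switching-caged-modulus` (support lever shared by the two lines): the switching identity
  turning a move of ONE insertion point of an `n`-point function into a double-current connection
  probability, and the cross-scale insertion-forgetting statement (ADC–Panis mixing).
* §3 `monotone-blocking-port`: the monotone-blocking conjecture BM₂ / BM typed at `β_c(3)`.
-/

noncomputable section

open Filter Topology Finset MeasureTheory
open Literature.Probability.LatticeModels
open Summit.CriticalPhenomena.Ising3DConformalLimit.Cruxes.ExistsScaleCovariantLimit.BlockZoomExactOrbit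
open Classical

namespace Summit.CriticalPhenomena.Ising3DConformalLimit.Cruxes.ExistsScaleCovariantLimit.Ideator4

/-! ## §0 Common vocabulary -/

/-- Nearest-neighbour step of `ℤ³`. -/
def IsNN (v : Site 3) : Prop := ∃ i : Fin 3, v = Pi.single i 1 ∨ v = -Pi.single i 1

/-- Range-`p` axis step `± p e_i`. -/
def IsAxisStep (p : ℕ) (v : Site 3) : Prop := ∃ i : Fin 3, v = Pi.single i (p : ℤ) ∨ v = -Pi.single i (p : ℤ)

/-- `x` lies on the sublattice `p ℤ³`. -/
def OnSub (p : ℕ) (x : Site 3) : Prop := ∀ i : Fin 3, (p : ℤ) ∣ x i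

/-- The cube `{0,…,L-1}³` (block of side `L` anchored at the origin). -/
def cube (L : ℕ) : Finset (Site 3) := Fintype.piFinset fun _ => Finset.Ico (0 : ℤ) L

/-! ## §1 Card `decimation-homotopy-rate` -/

/-- The two-coupling ferromagnet on the box `Λ_L = {-L,…,L}³` (free boundary): ordered-pair couplings
`K/2` on nearest-neighbour pairs and `J/2` on pairs `(x, x ± p e_i)` with BOTH ends on `p ℤ³`
(so the unordered n.n. bond carries `K`, the sublattice range-`p` bond carries `J`).  At `J = 0` this is
the homogeneous n.n. model at `K`; at `K = 0` the sublattice spins form the n.n. Ising model on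
`p ℤ³ ≅ ℤ³` at coupling `J` and every other spin is free. -/
def decimationCoupling (p L : ℕ) (K J : ℝ) : ↥(box 3 L) → ↥(box 3 L) → ℝ := fun a b =>
  if IsNN (b.1 - a.1) then K / 2
  else if OnSub p a.1 ∧ OnSub p b.1 ∧ IsAxisStep p (b.1 - a.1) then J / 2 else 0

/-- The homogeneous nearest-neighbour coupling `J` on the box `Λ_L` (free boundary). -/
def nnCoupling (L : ℕ) (J : ℝ) : ↥(box 3 L) → ↥(box 3 L) → ℝ := fun a b =>
  if IsNN (b.1 - a.1) then J / 2 else 0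

/-- Spin monomial of lattice sites read inside the box (junk factor `1` for a site outside). -/
def boxMonomial (L : ℕ) {n : ℕ} (x : Fin n → Site 3) (σ : SpinConfig ↥(box 3 L)) : ℝ :=
  ∏ i, if h : x i ∈ box 3 L then spinAt (⟨x i, h⟩ : ↥(box 3 L)) σ else 1

/-- **ENDPOINT IDENTITY** (exact, provable now; the `K = 0` end of the path IS the coarser mesh): at
`K = 0` the free spins off `pℤ³` integrate out, and the correlations of sublattice spins `p·x` in the
box `Λ_{pL}` equal the correlations of the homogeneous n.n. model at coupling `J` in the box `Λ_L` at the
sites `x`. -/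
def EndpointIdentity (p : ℕ) : Prop :=
  ∀ (L : ℕ) (J : ℝ) (n : ℕ) (x : Fin n → Site 3), (∀ i, x i ∈ box 3 L) →
    PairIsing.gibbsAvg (decimationCoupling p (p * L) 0 J) (boxMonomial (p * L) (fun i => (p : ℤ) • x i)) =
      PairIsing.gibbsAvg (nnCoupling L J) (boxMonomial L x)

/-- **RESPONSE IDENTITY** (finite volume, provable now — Mathlib calculus): the derivative of a Gibbs
average along a straight path of couplings is the covariance with the tangent energy
`H' = Σ_{a,b} c'_{ab} σ_a σ_b`. -/
def ResponseIdentity : Prop :=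
  ∀ (L : ℕ) (c c' : ↥(box 3 L) → ↥(box 3 L) → ℝ) (f : SpinConfig ↥(box 3 L) → ℝ),
    HasDerivAt (fun s : ℝ => PairIsing.gibbsAvg (fun a b => c a b + s * c' a b) f)
      (PairIsing.gibbsAvg c (fun σ => f σ * ∑ a, ∑ b, c' a b * (spinAt a σ * spinAt b σ)) -
        PairIsing.gibbsAvg c f * PairIsing.gibbsAvg c (fun σ => ∑ a, ∑ b, c' a b * (spinAt a σ * spinAt b σ))) 0

/-- Infinite-volume (free b.c., `limUnder`, junk if divergent) correlation of sublattice spins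
`p·x_1,…,p·x_n` in the two-coupling model. -/
def subCorr (p : ℕ) (K J : ℝ) (n : ℕ) (x : Fin n → Site 3) : ℝ :=
  limUnder atTop fun L : ℕ =>
    PairIsing.gibbsAvg (decimationCoupling p L K J) (boxMonomial L (fun i => (p : ℤ) • x i))

/-- The critical sublattice coupling given the n.n. coupling `K`:
`J_χ(K) = inf {J ≥ 0 : the sublattice two-point function is not summable}` (susceptibility threshold =
critical point by sharpness, Aizenman–Barsky–Fernández / Duminil-Copin–Tassion). -/
def Jcrit (p : ℕ) (K : ℝ) : ℝ :=
  sInf {J : ℝ | 0 ≤ J ∧ ¬ Summable (fun x : Site 3 => subCorr p K J 2 ![0, x])}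

/-- **CRITICAL CURVE** (support, L-sized, provable track: GKS monotonicity, Aizenman–Grimmett
essential-enhancement differential inequalities for Lipschitz continuity, ABF/DCT sharpness,
ADS-type continuity via bond-plane reflection positivity which the period-`p` pattern keeps):
`K ↦ J_χ(K)` is antitone and continuous on `[0, β_c(3)]`, joins `(0, β_c)` to `(β_c, 0)`, and the
transition is continuous along it (the critical sublattice two-point function decays to `0`). -/
def DecimationCriticalCurve (p : ℕ) : Prop :=
  AntitoneOn (Jcrit p) (Set.Icc 0 (criticalBeta 3)) ∧ ContinuousOn (Jcrit p) (Set.Icc 0 (criticalBeta 3)) ∧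
    Jcrit p 0 = criticalBeta 3 ∧ Jcrit p (criticalBeta 3) = 0 ∧
    ∀ K ∈ Set.Icc (0:ℝ) (criticalBeta 3),
      Tendsto (fun x : Site 3 => subCorr p K (Jcrit p K) 2 ![0, x]) cofinite (𝓝 0)

/-- Normalised block moment of sublattice spins along the critical curve, block side `L` (in
sublattice units), offsets `k_i` (block units): `R_K(L; k) = Σ_{x_i ∈ cube L} ⟨∏ σ_{p(x_i + L k_i)}⟩ / V_K(L)^{n/2}`,
`V_K(L)` the sublattice block variance. At `K = β_c` (`J = 0`) these are the sublattice-sampled block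
moments of the critical n.n. model at scale `pL`; at `K = 0` (`J = β_c`) they are its ORDINARY block
moments at scale `L` (`EndpointIdentity`). -/
def pathBlockMoment (p : ℕ) (K : ℝ) (n L : ℕ) (k : Fin n → Site 3) : ℝ :=
  (∑ x ∈ Fintype.piFinset (fun _ : Fin n => cube L),
      subCorr p K (Jcrit p K) n (fun i => x i + (L : ℤ) • k i)) /
    (∑ x ∈ cube L, ∑ y ∈ cube L, subCorr p K (Jcrit p K) 2 ![x, y]) ^ ((n : ℝ) / 2)

/-- **PATH RIGIDITY = LOCAL UNIVERSALITY WITH A RATE (the load-bearing conjecture of the card).**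
Along the whole critical curve the normalised block moments of sublattice spins change by at most
`C L^{-θ}`: the tangent of a curve of critical finite-range ferromagnets acts on macroscopic spin
correlations as a pure multiplicative renormalisation up to an irrelevant remainder (`θ` is expected to
be the correction-to-scaling exponent `ω ≈ 0.83`). Integrated (FTC) form, so no differentiability of
`J_χ` is presupposed. -/
def PathRigidity (p : ℕ) : Prop :=
  ∃ θ : ℝ, 0 < θ ∧ ∀ (n : ℕ) (k : Fin n → Site 3), ∃ C : ℝ, ∀ (L : ℕ), 1 ≤ L →
    ∀ K ∈ Set.Icc (0:ℝ) (criticalBeta 3), ∀ K' ∈ Set.Icc (0:ℝ) (criticalBeta 3),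
      |pathBlockMoment p K n L k - pathBlockMoment p K' n L k| ≤ C * (L : ℝ) ^ (-θ)

/-- Normalised block moments of the critical n.n. model itself (plus state = the unique critical state):
`R(L; k) = Σ_{x_i ∈ cube L} ⟨∏ σ_{x_i + L k_i}⟩_{β_c} / blockVar'(L)^{n/2}`. -/
def critBlockMoment (n L : ℕ) (k : Fin n → Site 3) : ℝ :=
  (∑ x ∈ Fintype.piFinset (fun _ : Fin n => cube L), criticalCorr 3 n (fun i => x i + (L : ℤ) • k i)) /
    (∑ x ∈ cube L, ∑ y ∈ cube L, criticalTwoPoint 3 (y - x)) ^ ((n : ℝ) / 2)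

/-- **STAGGERED FIELD NEGLIGIBLE** (provable now, M: infrared bound at the corner momenta
`(π,π,π)`-type + `blockVar ≥ c L³ χ_{L/2}`): sampling every `p`-th spin of a block of side `pL` instead
of all its spins changes the normalised block moments by `≤ C L^{-θ₀}` (`θ₀ = (2-η)/2 ≥ 1/2`). -/
def StaggeredNegligible (p : ℕ) : Prop :=
  ∃ θ₀ : ℝ, 0 < θ₀ ∧ ∀ (n : ℕ) (k : Fin n → Site 3), ∃ C : ℝ, ∀ L : ℕ, 1 ≤ L →
    |pathBlockMoment p (criticalBeta 3) n L k - critBlockMoment n (p * L) k| ≤ C * (L : ℝ) ^ (-θ₀)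

/-- **p-ADIC RATE** (the output of §1 for one `p`): consecutive meshes in ratio `p` have block moments
within `C L^{-θ}` — quantitative asymptotic `p`-self-similarity of the critical block-spin orbit. -/
def BlockRate (p : ℕ) : Prop :=
  ∃ θ : ℝ, 0 < θ ∧ ∀ (n : ℕ) (k : Fin n → Site 3), ∃ C : ℝ, ∀ L : ℕ, 1 ≤ L →
    |critBlockMoment n (p * L) k - critBlockMoment n L k| ≤ C * (L : ℝ) ^ (-θ)

/-- The §1 chain for one `p` (pure bookkeeping once the four inputs are in: triangle inequality through
the two endpoints of the curve). -/
def RateFromPath (p : ℕ) : Prop :=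
  DecimationCriticalCurve p → EndpointIdentity p → StaggeredNegligible p → PathRigidity p → BlockRate p

/-- **RATES ⇒ FULL-FILTER SMEARED CONVERGENCE** (M-sized glue: `log 3 / log 2 ∉ ℚ`, geometric summation
of the rates down the dyadic/triadic chains, scale-continuity of block-normalised smeared moments from
`BlockMomentBounds`, Riemann-sum passage from integer blocks to Schwartz test functions):
`BlockRate 2 ∧ BlockRate 3 ⇒ FieldMomentConvergence` (the interface of `BlockZoomSupport.lean`). -/
def RatesToFieldMomentConvergence : Prop :=
  BlockRate 2 → BlockRate 3 → BlockMomentBounds → FieldMomentConvergence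

/-! ## §2 Support lever `switching-caged-modulus` -/

/-- **SWITCHING–MODULUS IDENTITY** (Griffiths–Hurst–Sherman / Aizenman switching lemma, infinite
volume at `β_c(3)`; provable from the tree's `tsum_switching` + `sourcedDoubleCurrent_limit_exists` +
box limits): moving ONE insertion point of an `n`-point function from `x` to `y` is governed by the
probability that `y` joins the cluster of the source `x` in the double current with sources `A ∪ {x}`:
`⟨σ_A σ_y⟩ ⟨σ_x σ_y⟩ = ⟨σ_A σ_x⟩ · P^{A∪{x},∅}_{β_c}[x ↔ y in n₁+n₂]`. With `A = {z}` it reads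
`⟨σ_zσ_y⟩/⟨σ_zσ_x⟩ = P^{zx,∅}[x↔y]/⟨σ_xσ_y⟩`: the `n`-point relative modulus equals the two-point one
as soon as the current near the source `x` forgets whether its far partners are one point or many. -/
def SwitchingModulusIdentity : Prop :=
  ∀ (A : Finset (Site 3)) (x y : Site 3), x ∉ A → y ∉ A → x ≠ y → Odd A.card →
    plusCorr 3 (criticalBeta 3) 0 (insert y A) * criticalTwoPoint 3 (y - x) =
      plusCorr 3 (criticalBeta 3) 0 (insert x A) *
        (sourcedDoubleCurrentLawInf 3 (criticalBeta 3) (insert x A) ∅).real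
          {ω | (Literature.Probability.Percolation.openGraph ω).Reachable x y}

/-- **INSERTION FORGETTING (qualitative)** (ADC 2021 mixing for sourced currents, d = 3 form completed
in Panis 2024 §5; L-sized, provable track): the probability that the NEIGHBOUR `x + e` of the source `x` joins
the cluster of `x` converges, as all other sources recede, to a limit independent of their configuration
— and that limit is the bulk bond value `⟨σ₀σ_e⟩_{β_c}` (take one partner `z → ∞` along an axis, where
`⟨σ_zσ_{x+e}⟩/⟨σ_zσ_x⟩ → 1` is unconditional by log-convexity + the power bounds, and use the switching
identity). USE: absorbs every O(1)-lattice-step rounding (`⌊x/δ⌋` vs sublattice representatives) in the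
pointwise form of the §1 chain; it does NOT give a macroscopic modulus (errors are absolute, steps are many). -/
def InsertionForgetting : Prop :=
  ∀ (m : ℕ) (ε : ℝ), 0 < ε → ∃ R₀ : ℝ, 0 < R₀ ∧ ∀ (A : Finset (Site 3)) (x e : Site 3),
    A.card ≤ m → Odd A.card → x ∉ A → x + e ∉ A → IsNN e → (∀ a ∈ A, R₀ ≤ ‖toE a - toE x‖) →
      |(sourcedDoubleCurrentLawInf 3 (criticalBeta 3) (insert x A) ∅).real
          {ω | (Literature.Probability.Percolation.openGraph ω).Reachable x (x + e)} -
        criticalTwoPoint 3 e| ≤ ε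

/-- **NEAR-SOURCE FORGETTING WITH RATE 1/R** (conjecture; by the switching identity it is EQUIVALENT to the
`n`-point relative gradient bound `|⟨σ_Aσ_{x+e}⟩/⟨σ_Aσ_x⟩ − 1| ≤ C/dist(x,A)`, i.e. to the caged modulus
itself with Lipschitz rate — a REFORMULATION in current language (one local event, uniform in far sources),
not a proof; for `A = {z}` it is the two-point gradient regularity of ADC 2021 §5 / DC–Panis at regular
scales). Exploring the partner backbones inward reduces it to TWO-point statements in domains with far
defects (boundary-condition insensitivity + a Harnack-type local flatness), both open off the RP-symmetric
full space (NOTES.md Barrier note B3). -/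
def NearSourceForgettingRate : Prop :=
  ∀ m : ℕ, ∃ C : ℝ, ∀ (A : Finset (Site 3)) (x e : Site 3) (R : ℝ), 1 ≤ R →
    A.card ≤ m → Odd A.card → x ∉ A → x + e ∉ A → IsNN e → (∀ a ∈ A, R ≤ ‖toE a - toE x‖) →
      |(sourcedDoubleCurrentLawInf 3 (criticalBeta 3) (insert x A) ∅).real
          {ω | (Literature.Probability.Percolation.openGraph ω).Reachable x (x + e)} -
        criticalTwoPoint 3 e| ≤ C * criticalTwoPoint 3 e / R

/-- **CAGED-MODULUS REDUCTION** (provable GIVEN its hypotheses, M: per lattice step the relative change of an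
`n`-point function is `≤ C δ / m` by the switching identity + the rate, and a macroscopic move of size `r` is
`r/δ` steps, total `≤ C r / m`; with `UniformBounds` this is clause (b) of `NPointEquicontinuity` at EVERY
configuration, caged or not). The open content is `NearSourceForgettingRate`, equivalent in strength to
item 4658 (b); recorded so that a current-based proof has a precise target. -/
def CagedModulusReduction : Prop :=
  SwitchingModulusIdentity → NearSourceForgettingRate → UniformBounds → NPointEquicontinuity

/-! ## §3 Card `monotone-blocking-port` (lever of the summit card `monotone-blocking`, typed at β_c) -/

/-- Block covariance of the critical n.n. model: `C(L; k) = Σ_{x,y ∈ cube L} ⟨σ_x σ_{y + L k}⟩_{β_c}`. -/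
def blockCov (L : ℕ) (k : Site 3) : ℝ :=
  ∑ x ∈ cube L, ∑ y ∈ cube L, criticalTwoPoint 3 (y - x + (L : ℤ) • k)

/-- **BM₂ (monotone blocking, two-point level)**: `L ↦ ρ(L;k) = C(L;k)/C(L;0)` is non-decreasing for every
block offset `k`. -/
def MonotoneBlockingTwo : Prop :=
  ∀ (k : Site 3) (L : ℕ), 1 ≤ L → blockCov L k / blockCov L 0 ≤ blockCov (L + 1) k / blockCov (L + 1) 0

/-- **GEOMETRIC LOG-CONVEXITY OF THE BLOCK VARIANCE (DLC for `p = 2`, TLC for `p = 3`)** — the minimal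
`n = 2` form of monotone blocking: `V(p²L)·V(L) ≥ V(pL)²`, `V(L) = blockCov L 0`. With `V` non-decreasing it
makes `j ↦ log V(pʲL)` convex with bounded increments, so `V(pʲ⁺¹L)/V(pʲL)` converges; for `p = 2, 3` together
(Karamata along two multiplicatively independent integers) `V` is regularly varying: `η(3)` exists. -/
def GeometricLogConvexity (p : ℕ) : Prop :=
  ∀ L : ℕ, 1 ≤ L → blockCov (p * L) 0 ^ 2 ≤ blockCov (p * p * L) 0 * blockCov L 0

/-- **BM (all normalised block moments monotone)** — the strong form under which "monotone + bounded ⇒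
convergent" delivers every block moment along the full integer filter. -/
def MonotoneBlockingAll : Prop :=
  ∀ (n : ℕ) (k : Fin n → Site 3), Monotone (fun L : ℕ => critBlockMoment n (L + 1) k) ∨
    Antitone (fun L : ℕ => critBlockMoment n (L + 1) k)

/-- The §3 chain: BM ⇒ every `critBlockMoment n · k` converges (monotone and bounded by Newman/Griffiths),
which with scale-continuity and the Riemann-sum glue is `FieldMomentConvergence`. -/
def MonotoneToFieldMomentConvergence : Prop :=
  MonotoneBlockingAll → BlockMomentBounds → FieldMomentConvergence

/-! ## The common tail (kernel of every line of this seat): smeared convergence + the caged modulus ⇒ crux,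
through the PROVED reduction of `BlockZoomSupport.lean`. -/

theorem crux_of_fieldMomentConvergence_and_modulus
    (hSP : SmearedToPointwise) (hNW : NonWhiteSubsequence)
    (hred : CagedModulusReduction) (hsw : SwitchingModulusIdentity) (hNSF : NearSourceForgettingRate)
    (hUB : UniformBounds) (hF : FieldMomentConvergence) :
    Summit.CriticalPhenomena.Ising3DConformalLimit.Theses.HyperoctahedralRP.ExistsScaleCovariantLimit :=
  existsScaleCovariantLimit_of_fieldMomentConvergence hSP hNW (hred hsw hNSF hUB) hF


/-- Card `decimation-homotopy-rate`, composed to the crux BY NAME (shape of the future skeleton: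
the stubs are the hypotheses; `PathRigidity 2/3` is load-bearing). -/
theorem crux_of_pathRigidity
    (hcurve2 : DecimationCriticalCurve 2) (hcurve3 : DecimationCriticalCurve 3)
    (hend2 : EndpointIdentity 2) (hend3 : EndpointIdentity 3)
    (hstag2 : StaggeredNegligible 2) (hstag3 : StaggeredNegligible 3)
    (hPR2 : PathRigidity 2) (hPR3 : PathRigidity 3)
    (hchain2 : RateFromPath 2) (hchain3 : RateFromPath 3)
    (hT : BlockMomentBounds) (hglue : RatesToFieldMomentConvergence)
    (hSP : SmearedToPointwise) (hNW : NonWhiteSubsequence)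
    (hred : CagedModulusReduction) (hsw : SwitchingModulusIdentity) (hNSF : NearSourceForgettingRate)
    (hUB : UniformBounds) :
    Summit.CriticalPhenomena.Ising3DConformalLimit.Theses.HyperoctahedralRP.ExistsScaleCovariantLimit :=
  crux_of_fieldMomentConvergence_and_modulus hSP hNW hred hsw hNSF hUB
    (hglue (hchain2 hcurve2 hend2 hstag2 hPR2) (hchain3 hcurve3 hend3 hstag3 hPR3) hT)


/-- Variant tail through the SHARED compactness milestone (item 4658) instead of the current-language
conjecture: `OfStarRegularity` is BlockZoomSupport's provable glue. -/
theorem crux_of_pathRigidity'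
    (hcurve2 : DecimationCriticalCurve 2) (hcurve3 : DecimationCriticalCurve 3)
    (hend2 : EndpointIdentity 2) (hend3 : EndpointIdentity 3)
    (hstag2 : StaggeredNegligible 2) (hstag3 : StaggeredNegligible 3)
    (hPR2 : PathRigidity 2) (hPR3 : PathRigidity 3)
    (hchain2 : RateFromPath 2) (hchain3 : RateFromPath 3)
    (hT : BlockMomentBounds) (hglue : RatesToFieldMomentConvergence)
    (hSP : SmearedToPointwise) (hNW : NonWhiteSubsequence) (hG : OfStarRegularity)
    (hReg : Summit.CriticalPhenomena.Ising3DConformalLimit.Theses.MirrorHoelderCompactness.UniformRegularity) :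
    Summit.CriticalPhenomena.Ising3DConformalLimit.Theses.HyperoctahedralRP.ExistsScaleCovariantLimit :=
  existsScaleCovariantLimit_of_fieldMomentConvergence' hSP hNW hG hReg
    (hglue (hchain2 hcurve2 hend2 hstag2 hPR2) (hchain3 hcurve3 hend3 hstag3 hPR3) hT)

/-- Card `monotone-blocking-port`, composed to the crux BY NAME (`MonotoneBlockingAll` load-bearing). -/
theorem crux_of_monotoneBlocking
    (hBM : MonotoneBlockingAll) (hT : BlockMomentBounds) (hmono : MonotoneToFieldMomentConvergence)
    (hSP : SmearedToPointwise) (hNW : NonWhiteSubsequence)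
    (hred : CagedModulusReduction) (hsw : SwitchingModulusIdentity) (hNSF : NearSourceForgettingRate)
    (hUB : UniformBounds) :
    Summit.CriticalPhenomena.Ising3DConformalLimit.Theses.HyperoctahedralRP.ExistsScaleCovariantLimit :=
  crux_of_fieldMomentConvergence_and_modulus hSP hNW hred hsw hNSF hUB (hmono hBM hT)

end Summit.CriticalPhenomena.Ising3DConformalLimit.Cruxes.ExistsScaleCovariantLimit.Ideator4

end
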